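import Summits.Ventures.CertifiedManyBodySolver.Rows.CorrWindowCertKernelChainQuot
import HarnessLib

/-!
# The hinted quotient step WITH AUTOMATIC ADJOINT CANONICALISATION: every monomial `m` of a (quotiented) slice is replaced by the
# key-smaller of `m` and its adjoint's normal form, the difference going into the certificate's anti-Hermitian family — no hints, no data

HONEST FRAMING: Lean plumbing towards «tier P». The La214 programs identify a word with its ADJOINT (`ω(w†) = conj ω(w)`, real parts
equal) besides translations × box-`D₄`; replayed over raw words, an eom-carrying certificate leaves an anti-Hermitian residue
(`Σ λ_r [H, X_r]` is not Hermitian) that closes only through the window certificate's anti-Hermitian family `Σ_V (V† − V)`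
(`ahT AV` of `Rows/CorrWindowCertKernelFormGram.lean`, zero real expectation). This file makes that identification AUTOMATIC inside the
chain step: after the hinted quotient (`quotSlice`, `Rows/CorrWindowCertKernelChainQuot.lean`) each term `(m, c)` whose adjoint word
normal-orders to `ε·m'` with `key m' < key m` is replaced by `(m', ε·c)`, and `V := −c·m` is RECORDED — since
`c·m = (V† − V) + ε c·m'`, the denoted operator changes by exactly one `(V† − V)`; the check is the engine's own `normalize` on ONE
reversed word (`evalPoly_normalize'`), so no instance data and no hypothesis is involved. `stepEQA` = hinted quotient (with the ZERO-CLASS rule: a hint whose move flips the sign of its own monomial DROPS the term, `ω(m) = 0`)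
+ adjoint pass + merge;
`evalPoly_stepEQA`, `ChainQAOK`, `evalPoly_chainQA_nil`; the closer is `Rows/CorrWindowCertKernelChainQuotAdjCloser.lean`. Nothing of
record moves; no claim node is discharged; CONTROL/CALIBRATION context (wording (xx1)); silent on the presence of superconductivity;
not a `T_c` or phase sentence; nothing about any material; no summit statement is proved by this file. Seat hubbard-obs-p2
(STIFFNESS), `prover-hubbard-obs-p2-g23-0`, zero compute.

References: X. Han, arXiv:2006.06002 §3 (Hermiticity / symmetry reduction of the moment matrices) [Han2020Bootstrap]; J. Wang et al.,
PRX 14 (2024) 031006 §III [WangEtAl2024]; C. Jansson, D. Chaykin, C. Keil, SIAM J. Numer. Anal. 46 (2008) 180 [JanssonChaykinKeil2008];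
O. Bratteli, D. W. Robinson, *Operator Algebras and Quantum Statistical Mechanics 2* §5.2.2 [BratteliRobinsonII1997].
-/

namespace Summit.Ventures.CertifiedManyBodySolver

namespace CARPolyWindow

open Summit.Ventures.CertifiedQuantumChemistry Summit.Ventures.CertifiedQuantumChemistry.CARPoly
open Literature.MathematicalPhysics.QuantumLattice Literature.MathematicalPhysics.QuantumLattice.HubbardWave0
open Literature.MathematicalPhysics.QuantumManyBody.StateRelaxation
open Literature.Probability.LatticeModels ThermodynamicLimit Filter Topology
open Matrix
open scoped ComplexOrder BigOperators

/-! ## §0 The hinted quotient with the ZERO-CLASS rule (computable) -/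

section ZeroData

variable {N Nβ : ℕ}

/-- ZERO-CLASS test of an accepted hint `(ε, h)` on the monomial `m`: the move flips the sign (`ε = −1`) AND the pushed inner monomial
IS `m` (the engine's normal form of the pushed word is `(m, 1)`) — then `ω(m) = 0` by symmetry and the term is DROPPED, the move
`Y := [(word μ, −c/2)]` accounting for it (`c·m = −(c/2)(Γ(μ) − push μ)`). [cite: Han2020Bootstrap, §3] -/
def zeroQ (D : QuotData N Nβ) (B : ℕ) (m : CARPoly.Mono (Orb (Fin N))) (e : ℚ × QHint Nβ) : Bool :=
  decide (e.1 = -1) && decide (CARPoly.normalize SOSDual.encL B [(Mono.word (mapMono D.f e.2.μ), 1)] = [(m, 1)])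

/-- The quotiented term list with the zero-class rule: kept terms as words; accepted terms replaced by the pushed inner monomial with
coefficient `c/ε`, or DROPPED when zero-class. [cite: Han2020Bootstrap, §3] -/
def quotOutZ (D : QuotData N Nβ) (B : ℕ) (A : List (ATerm N Nβ)) : Terms (Orb (Fin N)) :=
  A.flatMap fun a => match a.2 with
    | none => [(Mono.word a.1.1, a.1.2)]
    | some e => if zeroQ D B a.1.1 e then [] else [(Mono.word (mapMono D.f e.2.μ), a.1.2 / e.1)]

/-- The accepted moves with the zero-class rule (`Y = [(word μ, −c/2)]` for a zero-class term, else `[(word μ, c/ε)]`).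
[cite: Han2020Bootstrap, §3] -/
def quotMovesZ (D : QuotData N Nβ) (B : ℕ) (A : List (ATerm N Nβ)) : List (Fin 8 × (ℤ × ℤ) × Terms (Orb (Fin Nβ))) :=
  A.filterMap fun a => a.2.map fun e =>
    (e.2.γ, (e.2.v, [(Mono.word e.2.μ, if zeroQ D B a.1.1 e then -(a.1.2 / 2) else a.1.2 / e.1)]))

/-- The quotiented slice (zero-class edition). [cite: Han2020Bootstrap, §3] -/
def quotSliceZ (D : QuotData N Nβ) (B : ℕ) (T : Terms (Orb (Fin N))) (H : List (QHint Nβ)) : Terms (Orb (Fin N)) :=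
  quotOutZ D B (annSlice D B T H)

/-- The accepted moves of a slice (zero-class edition). [cite: Han2020Bootstrap, §3] -/
def movesOfZ (D : QuotData N Nβ) (B : ℕ) (T : Terms (Orb (Fin N))) (H : List (QHint Nβ)) :
    List (Fin 8 × (ℤ × ℤ) × Terms (Orb (Fin Nβ))) :=
  quotMovesZ D B (annSlice D B T H)

/-- All accepted moves of the first `n` steps (zero-class edition). [folklore] -/
def allMovesZ (D : QuotData N Nβ) (B : ℕ) (Ts : List (Terms (Orb (Fin N)))) (Hs : List (List (QHint Nβ))) :
    ℕ → List (Fin 8 × (ℤ × ℤ) × Terms (Orb (Fin Nβ)))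
  | 0 => []
  | n + 1 => allMovesZ D B Ts Hs n ++ movesOfZ D B (Ts.getD n []) (Hs.getD n [])

/-- No step, no move. [folklore] -/
theorem allMovesZ_zero (D : QuotData N Nβ) (B : ℕ) (Ts : List (Terms (Orb (Fin N)))) (Hs : List (List (QHint Nβ))) :
    allMovesZ D B Ts Hs 0 = [] := rfl

/-- The moves of `n + 1` steps. [folklore] -/
theorem allMovesZ_succ (D : QuotData N Nβ) (B : ℕ) (Ts : List (Terms (Orb (Fin N)))) (Hs : List (List (QHint Nβ))) (n : ℕ) :
    allMovesZ D B Ts Hs (n + 1) = allMovesZ D B Ts Hs n ++ movesOfZ D B (Ts.getD n []) (Hs.getD n []) := rfl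

end ZeroData

/-! ## §1 The adjoint pass (computable) -/

section AdjData

variable {N Nβ : ℕ}

/-- The engine's normal form of the ADJOINT word of a monomial (one reversed, flipped word with coefficient `1`).
[cite: BratteliRobinsonII1997, §5.2.2] -/
def adjTgt (B : ℕ) (m : CARPoly.Mono (Orb (Fin N))) : CARPoly.Poly (Orb (Fin N)) :=
  CARPoly.normalize SOSDual.encL B [(daggerW (Mono.word m), 1)]

/-- One term after the adjoint pass: if the adjoint normal form is ONE signed monomial `(m', ε)` with a strictly smaller key, the
term becomes `(m', ε·c)` and the anti-Hermitian generator `V := [(word m, −c)]` is recorded; otherwise the term is kept.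
[cite: Han2020Bootstrap, §3] -/
def adjTerm (B : ℕ) (t : CARPoly.Mono (Orb (Fin N)) × ℚ) :
    (List (Orb (Fin N) × Bool) × ℚ) × Option (Terms (Orb (Fin N))) :=
  match adjTgt B t.1 with
  | [(m', ε)] =>
    if Mono.key SOSDual.encL B m' < Mono.key SOSDual.encL B t.1 then ((Mono.word m', ε * t.2), some [(Mono.word t.1, -t.2)])
    else ((Mono.word t.1, t.2), none)
  | _ => ((Mono.word t.1, t.2), none)

/-- The adjoint-canonicalised term list of a polynomial. [cite: Han2020Bootstrap, §3] -/
def adjOut (B : ℕ) (P : CARPoly.Poly (Orb (Fin N))) : Terms (Orb (Fin N)) := P.map fun t => (adjTerm B t).1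

/-- The recorded anti-Hermitian generators of a polynomial. [cite: Han2020Bootstrap, §3] -/
def adjMoves (B : ℕ) (P : CARPoly.Poly (Orb (Fin N))) : List (Terms (Orb (Fin N))) := P.filterMap fun t => (adjTerm B t).2

/-- The adjoint pass applied to the normal form of a term list. [folklore] -/
def adjSlice (B : ℕ) (T : Terms (Orb (Fin N))) : Terms (Orb (Fin N)) := adjOut B (CARPoly.normalize SOSDual.encL B T)

/-- The anti-Hermitian generators recorded for a term list. [folklore] -/
def adjMovesT (B : ℕ) (T : Terms (Orb (Fin N))) : List (Terms (Orb (Fin N))) := adjMoves B (CARPoly.normalize SOSDual.encL B T)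

/-- **One step of the chain with hinted quotient AND automatic adjoint canonicalisation.** [cite: JanssonChaykinKeil2008, §3]
[cite: Han2020Bootstrap, §3] -/
def stepEQA (D : QuotData N Nβ) (B : ℕ) (C : SOSDual.EncPoly) (T : Terms (Orb (Fin N))) (H : List (QHint Nβ)) : SOSDual.EncPoly :=
  SOSDual.mergeE B C (SOSDual.encPoly (CARPoly.normalize SOSDual.encL B (adjSlice B (quotSliceZ D B T H))))

/-- The anti-Hermitian generators recorded by one step. [folklore] -/
def adjOf (D : QuotData N Nβ) (B : ℕ) (T : Terms (Orb (Fin N))) (H : List (QHint Nβ)) : List (Terms (Orb (Fin N))) :=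
  adjMovesT B (quotSliceZ D B T H)

/-- All anti-Hermitian generators recorded by the first `n` steps. [folklore] -/
def allAdj (D : QuotData N Nβ) (B : ℕ) (Ts : List (Terms (Orb (Fin N)))) (Hs : List (List (QHint Nβ))) :
    ℕ → List (Terms (Orb (Fin N)))
  | 0 => []
  | n + 1 => allAdj D B Ts Hs n ++ adjOf D B (Ts.getD n []) (Hs.getD n [])

/-- No step, no generator. [folklore] -/
theorem allAdj_zero (D : QuotData N Nβ) (B : ℕ) (Ts : List (Terms (Orb (Fin N)))) (Hs : List (List (QHint Nβ))) :
    allAdj D B Ts Hs 0 = [] := rfl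

/-- The generators of `n + 1` steps. [folklore] -/
theorem allAdj_succ (D : QuotData N Nβ) (B : ℕ) (Ts : List (Terms (Orb (Fin N)))) (Hs : List (List (QHint Nβ))) (n : ℕ) :
    allAdj D B Ts Hs (n + 1) = allAdj D B Ts Hs n ++ adjOf D B (Ts.getD n []) (Hs.getD n []) := rfl

end AdjData

/-! ## §2 Soundness of the adjoint pass and of the step (no geometry, no data) -/

section AdjSound

variable {N Nβ : ℕ} {ι : Type*} [LinearOrder ι] [Fintype ι]

/-- `ahT` of no generator. [folklore] -/
theorem ahT_nil : ahT ([] : List (Terms (Orb (Fin N)))) = [] := rfl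

/-- `ahT` is additive in the generator list. [folklore] -/
theorem ahT_append (A B : List (Terms (Orb (Fin N)))) : ahT (A ++ B) = ahT A ++ ahT B := by
  simp [ahT, List.flatMap_append]

/-- `ahT` of a cons. [folklore] -/
theorem ahT_cons (V : Terms (Orb (Fin N))) (A : List (Terms (Orb (Fin N)))) : ahT (V :: A) = (daggerT V ++ negT V) ++ ahT A := rfl

/-- The adjoint IDENTITY behind the pass: if the adjoint word of `m` normal-orders to `(m', ε)`, then the reversed word denotes
`ε • m'`. [cite: BratteliRobinsonII1997, §5.2.2] -/
theorem ladderWord_daggerW_of_adjTgt {d : Orb (Fin N) → ι} (hd : Function.Injective d) (B : ℕ)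
    (m m' : CARPoly.Mono (Orb (Fin N))) (ε : ℚ) (h : adjTgt B m = [(m', ε)]) :
    ladderWord (wmap d (daggerW (Mono.word m))) = ((ε : ℚ) : ℂ) • evalMono d m' := by
  have e := evalPoly_normalize' hd SOSDual.encL B [(daggerW (Mono.word m), (1 : ℚ))]
  rw [← adjTgt, h, evalPoly_cons, evalPoly_nil, add_zero, termOp_cons, termOp_nil, add_zero, Rat.cast_one, one_smul] at e
  exact e.symm

/-- **Soundness of the adjoint pass**: the canonicalised terms denote the polynomial MINUS the anti-Hermitian family of the recorded
generators. [cite: Han2020Bootstrap, §3] -/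
theorem termOp_adjOut {d : Orb (Fin N) → ι} (hd : Function.Injective d) (B : ℕ) :
    ∀ P : CARPoly.Poly (Orb (Fin N)), termOp d (adjOut B P) = evalPoly d P - termOp d (ahT (adjMoves B P))
  | [] => by simp [adjOut, adjMoves, ahT]
  | t :: P => by
    have ih := termOp_adjOut hd B P
    obtain ⟨m, c⟩ := t
    have hO : adjOut B ((m, c) :: P) = (adjTerm B (m, c)).1 :: adjOut B P := rfl
    have hM : adjMoves B ((m, c) :: P) =
        (match (adjTerm B (m, c)).2 with | some V => V :: adjMoves B P | none => adjMoves B P) := by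
      rw [adjMoves, List.filterMap_cons]
      cases (adjTerm B (m, c)).2 <;> rfl
    rw [hO, hM, termOp_cons, ih, evalPoly_cons]
    -- case analysis on the pass
    unfold adjTerm
    split
    · rename_i m' ε htgt
      split_ifs with hlt
      · dsimp only
        rw [ahT_cons, termOp_append, termOp_append, termOp_negT]
        have hd1 : termOp d (daggerT [(Mono.word m, -c)]) = (((-c : ℚ)) : ℂ) • (((ε : ℚ) : ℂ) • evalMono d m') := by
          show termOp d [(daggerW (Mono.word m), -c)] = _
          rw [termOp_cons, termOp_nil, add_zero, ladderWord_daggerW_of_adjTgt hd B m m' ε htgt]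
        have hv : termOp d [(Mono.word m, -c)] = (((-c : ℚ)) : ℂ) • evalMono d m := by
          rw [termOp_cons, termOp_nil, add_zero]; rfl
        rw [hd1, hv, ladderWord_wmap_word, smul_smul]
        have e1 : ((((-c : ℚ)) : ℂ) * (((ε : ℚ)) : ℂ)) = -((((ε * c : ℚ)) : ℂ)) := by push_cast; ring
        have e2 : (((-c : ℚ)) : ℂ) = -(((c : ℚ)) : ℂ) := by push_cast; ring
        rw [e1, e2, neg_smul, neg_smul]
        abel
      · dsimp only
        rw [ladderWord_wmap_word]
        abel
    · dsimp only
      rw [ladderWord_wmap_word]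
      abel

/-- **Soundness of the adjoint-canonicalised slice.** [cite: Han2020Bootstrap, §3] -/
theorem termOp_adjSlice {d : Orb (Fin N) → ι} (hd : Function.Injective d) (B : ℕ) (T : Terms (Orb (Fin N))) :
    termOp d (adjSlice B T) = termOp d T - termOp d (ahT (adjMovesT B T)) := by
  rw [adjSlice, adjMovesT, termOp_adjOut hd, evalPoly_normalize' hd]

/-- A zero-class acceptance's second IDENTITY: the PUSHED inner monomial denotes the target monomial. [cite: BratteliRobinsonII1997, §5.2.2] -/
theorem ladderWord_pushed_of_zeroQ {d : Orb (Fin N) → ι} (hd : Function.Injective d) (D : QuotData N Nβ) (B : ℕ)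
    (m : CARPoly.Mono (Orb (Fin N))) (e : ℚ × QHint Nβ) (hz : zeroQ D B m e = true) :
    ladderWord (wmap d (Mono.word (mapMono D.f e.2.μ))) = evalMono d m ∧ e.1 = -1 := by
  simp only [zeroQ, Bool.and_eq_true, decide_eq_true_eq] at hz
  refine ⟨?_, hz.1⟩
  have h := evalPoly_normalize' hd SOSDual.encL B [(Mono.word (mapMono D.f e.2.μ), (1 : ℚ))]
  rw [hz.2, evalPoly_cons, evalPoly_nil, add_zero, termOp_cons, termOp_nil, add_zero, Rat.cast_one, one_smul, one_smul] at h
  exact h.symm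

/-- **Soundness of the zero-class quotient of an annotated list.** [cite: Han2020Bootstrap, §3] -/
theorem termOp_quotOutZ {d : Orb (Fin N) → ι} (hd : Function.Injective d) (D : QuotData N Nβ) (B : ℕ) :
    ∀ (A : List (ATerm N Nβ)),
      (∀ a ∈ A, ∀ e, a.2 = some e → D.ok e.2.γ e.2.v = true ∧ e.1 ≠ 0 ∧ hintTgt D B e.2 = [(a.1.1, e.1)]) →
      termOp d (quotOutZ D B A) = evalPoly d (A.map Prod.fst) - termOp d (symTL D.f (gq D) (quotMovesZ D B A))
  | [], _ => by simp [quotOutZ, quotMovesZ, symTL]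
  | a :: A, hA => by
    have ih := termOp_quotOutZ hd D B A fun a' ha' => hA a' (List.mem_cons_of_mem _ ha')
    obtain ⟨⟨m, c⟩, o⟩ := a
    cases o with
    | none =>
      have hq : quotOutZ D B ((((m, c), none) : ATerm N Nβ) :: A) = (Mono.word m, c) :: quotOutZ D B A := rfl
      have hm : quotMovesZ D B ((((m, c), none) : ATerm N Nβ) :: A) = quotMovesZ D B A := rfl
      rw [hq, hm, termOp_cons, ih, List.map_cons, evalPoly_cons, ladderWord_wmap_word]
      abel
    | some e =>
      obtain ⟨hok, hε, htgt⟩ := hA ((m, c), some e) (List.mem_cons_self) e rfl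
      have hmvY : ∀ q : ℚ, termOp d (wmapT (gq D (d4OfCode e.2.γ) (siteOfPair e.2.v)) [(Mono.word e.2.μ, q)]) =
          (((q : ℚ)) : ℂ) • (((e.1 : ℚ) : ℂ) • evalMono d m) := by
        intro q
        show termOp d [((Mono.word e.2.μ).map (fun l => (gq D (d4OfCode e.2.γ) (siteOfPair e.2.v) l.1, l.2)), q)] = _
        rw [termOp_cons, termOp_nil, add_zero, ← word_mapMono, ladderWord_moved_of_hintTgt hd D B e.2 m e.1 htgt]
      have hplY : ∀ q : ℚ, termOp d (wmapT D.f [(Mono.word e.2.μ, q)]) =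
          (((q : ℚ)) : ℂ) • ladderWord (wmap d (Mono.word (mapMono D.f e.2.μ))) := by
        intro q
        show termOp d [((Mono.word e.2.μ).map (fun l => (D.f l.1, l.2)), q)] = _
        rw [termOp_cons, termOp_nil, add_zero, ← word_mapMono]
      by_cases hzq : zeroQ D B m e = true
      · -- zero class: term dropped, move `−c/2`
        have hq : quotOutZ D B ((((m, c), some e) : ATerm N Nβ) :: A) = quotOutZ D B A := by
          simp [quotOutZ, hzq]
        have hm : quotMovesZ D B ((((m, c), some e) : ATerm N Nβ) :: A) =
            (e.2.γ, (e.2.v, [(Mono.word e.2.μ, -(c / 2))])) :: quotMovesZ D B A := by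
          simp [quotMovesZ, hzq]
        obtain ⟨hpush, hε1⟩ := ladderWord_pushed_of_zeroQ hd D B m e hzq
        rw [hq, hm, ih, List.map_cons, evalPoly_cons, symTL_cons, termOp_append, termOp_append, termOp_negT]
        dsimp only
        rw [hmvY, hplY, hpush, hε1, smul_smul]
        have e1 : ((((-(c / 2) : ℚ)) : ℂ) * (((-1 : ℚ)) : ℂ)) = (((c : ℚ)) : ℂ) - (((c / 2 : ℚ)) : ℂ) := by push_cast; ring
        have e2 : (((-(c / 2) : ℚ)) : ℂ) = -(((c / 2 : ℚ)) : ℂ) := by push_cast; ring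
        rw [e1, e2, sub_smul, neg_smul]
        abel
      · -- ordinary acceptance
        have hzq' : zeroQ D B m e = false := by simpa using hzq
        have hq : quotOutZ D B ((((m, c), some e) : ATerm N Nβ) :: A) =
            (Mono.word (mapMono D.f e.2.μ), c / e.1) :: quotOutZ D B A := by
          simp [quotOutZ, hzq']
        have hm : quotMovesZ D B ((((m, c), some e) : ATerm N Nβ) :: A) =
            (e.2.γ, (e.2.v, [(Mono.word e.2.μ, c / e.1)])) :: quotMovesZ D B A := by
          simp [quotMovesZ, hzq']
        rw [hq, hm, termOp_cons, ih, List.map_cons, evalPoly_cons, symTL_cons, termOp_append, termOp_append, termOp_negT]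
        dsimp only
        rw [hmvY, hplY, smul_smul, ← Rat.cast_mul, div_mul_cancel₀ c hε]
        abel

/-- **Soundness of the zero-class quotiented slice.** [cite: Han2020Bootstrap, §3] -/
theorem termOp_quotSliceZ {d : Orb (Fin N) → ι} (hd : Function.Injective d) (D : QuotData N Nβ) (B : ℕ)
    (T : Terms (Orb (Fin N))) (H : List (QHint Nβ)) :
    termOp d (quotSliceZ D B T H) = termOp d T - termOp d (symTL D.f (gq D) (movesOfZ D B T H)) := by
  rw [quotSliceZ, movesOfZ, annSlice, termOp_quotOutZ hd D B _ (annotate_ok D B _ _), annotate_map_fst, evalPoly_normalize' hd]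

variable [NeZero N]

/-- **Soundness of one step with quotient and adjoint pass**: `decPoly N (stepEQA D B C T H)` denotes
`decPoly N C + termOp d T − symTL(moves) − ahT(adjoint generators)`. [cite: JanssonChaykinKeil2008, §3] [cite: Han2020Bootstrap, §3] -/
theorem evalPoly_stepEQA {d : Orb (Fin N) → ι} (hd : Function.Injective d) (D : QuotData N Nβ) (B : ℕ) (C : SOSDual.EncPoly)
    (T : Terms (Orb (Fin N))) (H : List (QHint Nβ)) :
    evalPoly d (SOSDual.decPoly N (stepEQA D B C T H)) =
      evalPoly d (SOSDual.decPoly N C) + termOp d T - termOp d (symTL D.f (gq D) (movesOfZ D B T H)) -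
        termOp d (ahT (adjOf D B T H)) := by
  rw [stepEQA, evalPoly_decPoly_mergeE', SOSDual.decPoly_encPoly, evalPoly_normalize' hd, termOp_adjSlice hd, termOp_quotSliceZ hd,
    adjOf]
  abel

end AdjSound

/-! ## §3 Chains -/

section ChainQA

variable {N Nβ : ℕ}

/-- **The per-step kernel facts of a hinted, adjoint-canonicalising staged replay.** [cite: JanssonChaykinKeil2008, §3] -/
structure ChainQAOK (D : QuotData N Nβ) (B M : ℕ) (Cs : List SOSDual.EncPoly) (Ts : List (Terms (Orb (Fin N))))
    (Hs : List (List (QHint Nβ))) : Prop where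
  /-- the slice list has exactly `M` entries -/
  len : Ts.length = M
  /-- step `i` -/
  step : ∀ i : Fin M, Cs.getD (i.val + 1) [] = stepEQA D B (Cs.getD i.val []) (Ts.getD i.val []) (Hs.getD i.val [])

variable [NeZero N] {ι : Type*} [LinearOrder ι] [Fintype ι]

/-- The chain invariant after `n ≤ M` steps. [folklore] -/
theorem evalPoly_chainQA_take {d : Orb (Fin N) → ι} (hd : Function.Injective d) {D : QuotData N Nβ} {B M : ℕ}
    {Cs : List SOSDual.EncPoly} {Ts : List (Terms (Orb (Fin N)))} {Hs : List (List (QHint Nβ))} (h : ChainQAOK D B M Cs Ts Hs) :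
    ∀ n, n ≤ M → evalPoly d (SOSDual.decPoly N (Cs.getD n [])) =
      evalPoly d (SOSDual.decPoly N (Cs.getD 0 [])) + termOp d (Ts.take n).flatten -
        termOp d (symTL D.f (gq D) (allMovesZ D B Ts Hs n)) - termOp d (ahT (allAdj D B Ts Hs n))
  | 0, _ => by
    rw [List.take_zero, List.flatten_nil, termOp_nil, add_zero, allMovesZ_zero, symTL_nil, termOp_nil, sub_zero, allAdj_zero,
      ahT_nil, termOp_nil, sub_zero]
  | n + 1, hn => by
    have hlt : n < Ts.length := by rw [h.len]; omega
    have ih := evalPoly_chainQA_take hd h n (by omega)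
    rw [h.step ⟨n, by omega⟩, evalPoly_stepEQA hd, ih, allMovesZ_succ, symTL_append, termOp_append, allAdj_succ, ahT_append,
      termOp_append, List.take_succ_eq_append_getElem hlt, List.flatten_append, List.flatten_singleton, termOp_append,
      List.getD_eq_getElem _ _ hlt]
    generalize evalPoly d (SOSDual.decPoly N (Cs.getD 0 [])) = E0
    generalize termOp d (List.take n Ts).flatten = Tn
    generalize termOp d Ts[n] = t
    generalize termOp d (symTL D.f (gq D) (allMovesZ D B Ts Hs n)) = Sn
    generalize termOp d (symTL D.f (gq D) (movesOfZ D B Ts[n] (Hs.getD n []))) = sn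
    generalize termOp d (ahT (allAdj D B Ts Hs n)) = An
    generalize termOp d (ahT (adjOf D B Ts[n] (Hs.getD n []))) = an
    abel

/-- **Soundness of the chain from the empty accumulator.** [cite: JanssonChaykinKeil2008, §3] [cite: Han2020Bootstrap, §3] -/
theorem evalPoly_chainQA_nil {d : Orb (Fin N) → ι} (hd : Function.Injective d) {D : QuotData N Nβ} {B M : ℕ}
    {Cs : List SOSDual.EncPoly} {Ts : List (Terms (Orb (Fin N)))} {Hs : List (List (QHint Nβ))} (hC0 : Cs.getD 0 [] = [])
    (h : ChainQAOK D B M Cs Ts Hs) :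
    evalPoly d (SOSDual.decPoly N (Cs.getD M [])) =
      termOp d Ts.flatten - termOp d (symTL D.f (gq D) (allMovesZ D B Ts Hs M)) - termOp d (ahT (allAdj D B Ts Hs M)) := by
  have e := evalPoly_chainQA_take hd h M le_rfl
  rwa [List.take_of_length_le h.len.le, hC0, evalPoly_decPoly_nil, zero_add] at e

/-- **The residual WITH a symmetry family and EXTRA anti-Hermitian generators = the residual without them minus both families.**
[cite: WangEtAl2024, §III] -/
theorem termOp_residTG_moves_adj {α β : Type*} {ι : Type*} [LinearOrder ι] [Fintype ι] (d : α → ι)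
    (TX : Terms α) (μ : Fin 2 → ℚ) (ν : ℚ) (o : Fin 2 → α) (κhi hi κlo lo : ℚ) (TE : Terms α)
    (TG : Terms α) (TH : Terms α) (f : β → α) (EB : List (Terms β))
    {nS : ℕ} (g : Fin nS → β → α) (SY : Fin nS → Terms β) (CW : Terms α) (AV AV' : List (Terms α)) :
    termOp d (residTG TX μ ν o κhi hi κlo lo TE TG TH f EB g SY CW (AV ++ AV')) =
      termOp d (residTG TX μ ν o κhi hi κlo lo TE TG TH f EB (fun l : Fin 0 => l.elim0) (fun l : Fin 0 => l.elim0) CW AV) -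
        termOp d (symT f g SY) - termOp d (ahT AV') := by
  have h0 : symT f (fun l : Fin 0 => l.elim0) (fun l : Fin 0 => l.elim0) = ([] : Terms α) := rfl
  have hA : ahT (AV ++ AV') = ahT AV ++ ahT AV' := by simp [ahT, List.flatMap_append]
  simp only [residTG, hA, negT_append, termOp_append, termOp_negT, h0, termOp_nil, neg_zero, add_zero]
  abel

end ChainQA

end CARPolyWindow

end Summit.Ventures.CertifiedManyBodySolver
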